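import Summits.CriticalPhenomena.PercolationContinuityZ3.Theorems.PercNearOneGluingNoHeavyLowerTailAPLVwEasy
import HarnessLib

/-!
# `NoHeavyLowerTail` (stmt-CriticalPhenomena-4575) — (PV) for NONNEGATIVE loads is preserved by series and parallel
# composition: the algebraic skeleton of "(PV) holds on every two-terminal series–parallel graph"

Support file (prover prim-ineq-gen-8 gen 45; `--supports stmt-CriticalPhenomena-4575`; memo
run/shared/lean/prim/prim-ineq-gen-8/FINDING-gen45-SERIES.md §6).  No definitions, no named facts, no sorries.

SETTING.  A two-terminal graph `(H; y, v)` (apex `y`, vertex `v`), nonnegative loads on its INTERIOR vertices (loads on `y`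
and `v` are irrelevant for (PV), see below), `E = {y ↔ v}`, `q = P(Eᶜ)`, `τ = 1 − q`, and the four moments of the interior loads
`α = ℓ(C_y ∩ int)`, `β = ℓ(C_v ∩ int)`:  `a = E[α; Eᶜ]`, `b = E[β; Eᶜ]`, `c = E[α; E]`, `d = E[αβ; Eᶜ]` (all `≥ 0`).  In these
scalars the per-vertex quantities of `…APLVwEasy.lean` (apex `S = {y}`, vertex `v`, no load on `v`) are
  `N = Cov(1_E, ℓ(C_y)) = q c − τ a`,   `Γ = −Cov(ℓ(C_y), 1_{Eᶜ} ℓ(C_v)) = (a + c) b − d`,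
and (PV) is `N² ≤ 2τΓ`; Harris' inequality is `N ≥ 0`.  A load `t ≥ 0` on `v` changes `2τΓ − N²` by
`τ²q(2−q)t² + 2τ²(b + N)t ≥ 0` (memo §6), so the `t = 0` case is the whole of (PV) once `N ≥ 0`.
COMPOSITION RULES (independence of the pieces; memo §3, verified against brute-force enumeration):
  parallel `H₁ ∥ H₂`:        `q = q₁q₂`, `a = a₁q₂ + q₁a₂`, `b = b₁q₂ + q₁b₂`, `c = c₁ + c₂ + τ₂(a₁+b₁) + τ₁(a₂+b₂)`,
                             `d = d₁q₂ + q₁d₂ + a₁b₂ + a₂b₁`;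
  series `H₁(y,u)·H₂(u,v)`, load `r ≥ 0` at `u`:  `τ = τ₁τ₂`, `a = a₁ + q₂c₁ + τ₁(q₂r + a₂)`, `b = b₂ + q₁c₂ + τ₂(q₁r + b₁)`,
                             `c = τ₂c₁ + τ₁c₂ + τ₁τ₂r`, `d = a₁b₂ + c₁b₂ + τ₁(rb₂ + d₂) + a₁c₂ + τ₂(ra₁ + d₁)`;
  an edge has no interior (`a = b = c = d = 0`); hanging any graph at any vertex shifts a load by a nonnegative amount.

THIS FILE proves, as polynomial identities and their sign consequences [this work]:
* `pvp_N_series`, `pvp_N_parallel`: `N` of the composite is `τ₂N₁ + τ₁N₂ + τ₁τ₂q₁(r + a₂ + c₂)` resp.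
  `q₂N₁ + q₁N₂ + q₁q₂(τ₂b₁ + τ₁b₂)` — Harris' inequality propagates;
* `pvp_series_identity`: `2τΓ − N²` of the series composite `= τ₂²(2τ₁Γ₁ − N₁²) + τ₁²(2τ₂Γ₂ − N₂²) + 2τ₁²τ₂²N₁(r+m₂)
  + τ₁²τ₂²(r+m₂)(q₁(2−q₁)(r+m₂) + 2b₁)` (`m₂ = a₂ + c₂`) — manifestly nonnegative;
* `pvp_parallel_identity`: `τ₁τ₂(2τΓ − N²)` of the parallel composite `= τ₂q₂τ_G(2τ₁Γ₁ − N₁²) + τ₁q₁τ_G(2τ₂Γ₂ − N₂²)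
  + q₁q₂[τ₂N₁ − τ₁N₂ + τ₁τ₂(q₁b₂ − q₂b₁)]² + q₂τ₁τ₂²N₁² + q₁τ₁²τ₂N₂² + 2τ₁τ₂φ(b₂N₁ + b₁N₂)
  + (τ_G + φ)τ₁τ₂(q₂τ₂b₁² + q₁τ₁b₂²) + 2τ₁τ₂τ_G(q₂τ₁ + q₁τ₂)b₁b₂`, `φ = τ_G² + q₁q₂τ₁τ₂` — a copositivity certificate
  (the remainder is NOT positive semidefinite; the signs `N_i, b_i ≥ 0` are used);
* `pvp_series`, `pvp_parallel`: hence (PV) ∧ Harris for the pieces ⟹ (PV) ∧ Harris for the composite.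
CONSEQUENCE (memo §6; the gluing semantics are documented, not kernel statements): by induction over a series–parallel
decomposition, **(PV) `Cov(1[y↔v], ℓ(C_y))² ≤ 2P(y↔v)·(−Cov(ℓ(C_y), 1[y↮v]ℓ(C_v)))` holds for all nonnegative loads on every
two-terminal series–parallel graph `(G; y, v)` with arbitrary pendant subgraphs** — the first (PV) theorem with cycles (forests:
gen 41/44); consequently (V_w), (V) and (Q0) hold on every graph `G` with apex `s` such that each `(G; s, v)` is two-terminal
series–parallel (all cacti, in particular).  Contrast: the SIGNED version (PV-signed) fails already on `K_{2,64}`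
(`…APLVwThetaCounterexample.lean`).
-/

noncomputable section

namespace Summit.CriticalPhenomena.PercolationContinuityZ3.Theorems

namespace APL

/-! ### Harris' inequality `N ≥ 0` propagates -/

/-- **`N` under series composition.**  With `N_i = q_ic_i − (1−q_i)a_i` and the series rules of the module docstring,
`N = τ₂N₁ + τ₁N₂ + τ₁τ₂q₁(r + a₂ + c₂)`. [this work] -/
theorem pvp_N_series (q₁ a₁ c₁ q₂ a₂ c₂ r : ℝ) :
    (1 - (1 - q₁) * (1 - q₂)) * ((1 - q₂) * c₁ + (1 - q₁) * c₂ + (1 - q₁) * (1 - q₂) * r)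
      - (1 - q₁) * (1 - q₂) * (a₁ + q₂ * c₁ + (1 - q₁) * (q₂ * r + a₂)) =
    (1 - q₂) * (q₁ * c₁ - (1 - q₁) * a₁) + (1 - q₁) * (q₂ * c₂ - (1 - q₂) * a₂)
      + (1 - q₁) * (1 - q₂) * q₁ * (r + a₂ + c₂) := by
  ring

/-- **`N` under parallel composition.**  `N = q₂N₁ + q₁N₂ + q₁q₂((1−q₂)b₁ + (1−q₁)b₂)`. [this work] -/
theorem pvp_N_parallel (q₁ a₁ b₁ c₁ q₂ a₂ b₂ c₂ : ℝ) :
    (q₁ * q₂) * (c₁ + c₂ + (1 - q₂) * (a₁ + b₁) + (1 - q₁) * (a₂ + b₂)) - (1 - q₁ * q₂) * (a₁ * q₂ + q₁ * a₂) =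
    q₂ * (q₁ * c₁ - (1 - q₁) * a₁) + q₁ * (q₂ * c₂ - (1 - q₂) * a₂)
      + q₁ * q₂ * ((1 - q₂) * b₁ + (1 - q₁) * b₂) := by
  ring

/-! ### Series composition -/

/-- **Series identity for `2τΓ − N²`.**  Pieces `(q_i; a_i, b_i, c_i; d_i)`, cut-vertex load `r`, composite data by the series
rules; with `τ_i = 1 − q_i`, `N_i = q_ic_i − τ_ia_i`, `Γ_i = (a_i + c_i)b_i − d_i`, `m₂ = a₂ + c₂`:
`2τ₁τ₂Γ − N² = τ₂²(2τ₁Γ₁ − N₁²) + τ₁²(2τ₂Γ₂ − N₂²) + 2τ₁²τ₂²N₁(r + m₂) + τ₁²τ₂²(r + m₂)(q₁(2−q₁)(r + m₂) + 2b₁)`. [this work] -/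
theorem pvp_series_identity (q₁ a₁ b₁ c₁ d₁ q₂ a₂ b₂ c₂ d₂ r : ℝ) :
    2 * ((1 - q₁) * (1 - q₂)) *
        (((a₁ + q₂ * c₁ + (1 - q₁) * (q₂ * r + a₂)) + ((1 - q₂) * c₁ + (1 - q₁) * c₂ + (1 - q₁) * (1 - q₂) * r))
            * (b₂ + q₁ * c₂ + (1 - q₂) * (q₁ * r + b₁))
          - (a₁ * b₂ + c₁ * b₂ + (1 - q₁) * (r * b₂ + d₂) + a₁ * c₂ + (1 - q₂) * (r * a₁ + d₁)))
      - ((1 - (1 - q₁) * (1 - q₂)) * ((1 - q₂) * c₁ + (1 - q₁) * c₂ + (1 - q₁) * (1 - q₂) * r)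
          - (1 - q₁) * (1 - q₂) * (a₁ + q₂ * c₁ + (1 - q₁) * (q₂ * r + a₂))) ^ 2 =
    (1 - q₂) ^ 2 * (2 * (1 - q₁) * ((a₁ + c₁) * b₁ - d₁) - (q₁ * c₁ - (1 - q₁) * a₁) ^ 2)
    + (1 - q₁) ^ 2 * (2 * (1 - q₂) * ((a₂ + c₂) * b₂ - d₂) - (q₂ * c₂ - (1 - q₂) * a₂) ^ 2)
    + 2 * (1 - q₁) ^ 2 * (1 - q₂) ^ 2 * (q₁ * c₁ - (1 - q₁) * a₁) * (r + a₂ + c₂)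
    + (1 - q₁) ^ 2 * (1 - q₂) ^ 2 * (r + a₂ + c₂) * (q₁ * (2 - q₁) * (r + a₂ + c₂) + 2 * b₁) := by
  ring

/-- **(PV) for nonnegative loads is preserved by series composition.**  If both pieces satisfy (PV) `N_i² ≤ 2τ_iΓ_i` and
Harris `N_i ≥ 0`, and the data and the cut-vertex load are nonnegative (`q₁ ≤ 2` suffices for the sign of `q₁(2−q₁)`), then the
series composite satisfies (PV) — read off `pvp_series_identity`. [this work] -/
theorem pvp_series (q₁ a₁ b₁ c₁ d₁ q₂ a₂ b₂ c₂ d₂ r : ℝ)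
    (hq₁ : 0 ≤ q₁) (hq₁' : q₁ ≤ 1) (hb₁ : 0 ≤ b₁) (ha₂ : 0 ≤ a₂) (hc₂ : 0 ≤ c₂) (hr : 0 ≤ r)
    (hN₁ : 0 ≤ q₁ * c₁ - (1 - q₁) * a₁)
    (h₁ : (q₁ * c₁ - (1 - q₁) * a₁) ^ 2 ≤ 2 * (1 - q₁) * ((a₁ + c₁) * b₁ - d₁))
    (h₂ : (q₂ * c₂ - (1 - q₂) * a₂) ^ 2 ≤ 2 * (1 - q₂) * ((a₂ + c₂) * b₂ - d₂)) :
    ((1 - (1 - q₁) * (1 - q₂)) * ((1 - q₂) * c₁ + (1 - q₁) * c₂ + (1 - q₁) * (1 - q₂) * r)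
          - (1 - q₁) * (1 - q₂) * (a₁ + q₂ * c₁ + (1 - q₁) * (q₂ * r + a₂))) ^ 2 ≤
      2 * ((1 - q₁) * (1 - q₂)) *
        (((a₁ + q₂ * c₁ + (1 - q₁) * (q₂ * r + a₂)) + ((1 - q₂) * c₁ + (1 - q₁) * c₂ + (1 - q₁) * (1 - q₂) * r))
            * (b₂ + q₁ * c₂ + (1 - q₂) * (q₁ * r + b₁))
          - (a₁ * b₂ + c₁ * b₂ + (1 - q₁) * (r * b₂ + d₂) + a₁ * c₂ + (1 - q₂) * (r * a₁ + d₁))) := by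
  have hid := pvp_series_identity q₁ a₁ b₁ c₁ d₁ q₂ a₂ b₂ c₂ d₂ r
  have hm : 0 ≤ r + a₂ + c₂ := by linarith
  have t1 : 0 ≤ (1 - q₂) ^ 2 * (2 * (1 - q₁) * ((a₁ + c₁) * b₁ - d₁) - (q₁ * c₁ - (1 - q₁) * a₁) ^ 2) :=
    mul_nonneg (sq_nonneg _) (by linarith)
  have t2 : 0 ≤ (1 - q₁) ^ 2 * (2 * (1 - q₂) * ((a₂ + c₂) * b₂ - d₂) - (q₂ * c₂ - (1 - q₂) * a₂) ^ 2) :=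
    mul_nonneg (sq_nonneg _) (by linarith)
  have t3 : 0 ≤ 2 * (1 - q₁) ^ 2 * (1 - q₂) ^ 2 * (q₁ * c₁ - (1 - q₁) * a₁) * (r + a₂ + c₂) := by positivity
  have hk : 0 ≤ q₁ * (2 - q₁) * (r + a₂ + c₂) + 2 * b₁ := by
    have : 0 ≤ q₁ * (2 - q₁) := mul_nonneg hq₁ (by linarith)
    positivity
  have t4 : 0 ≤ (1 - q₁) ^ 2 * (1 - q₂) ^ 2 * (r + a₂ + c₂) * (q₁ * (2 - q₁) * (r + a₂ + c₂) + 2 * b₁) := by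
    positivity
  linarith

/-! ### Parallel composition: a copositivity certificate -/

/-- **Parallel identity for `2τΓ − N²` (multiplied by `τ₁τ₂`).**  Pieces `(q_i; a_i, b_i, c_i; d_i)`, composite by the parallel
rules, `τ_i = 1 − q_i`, `τ_G = 1 − q₁q₂`, `N_i = q_ic_i − τ_ia_i`, `Γ_i = (a_i+c_i)b_i − d_i`, `φ = τ_G² + q₁q₂τ₁τ₂`:
`τ₁τ₂(2τ_GΓ − N²) = τ₂q₂τ_G(2τ₁Γ₁ − N₁²) + τ₁q₁τ_G(2τ₂Γ₂ − N₂²) + q₁q₂[τ₂N₁ − τ₁N₂ + τ₁τ₂(q₁b₂ − q₂b₁)]²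
 + q₂τ₁τ₂²N₁² + q₁τ₁²τ₂N₂² + 2τ₁τ₂φ(b₂N₁ + b₁N₂) + (τ_G+φ)τ₁τ₂(q₂τ₂b₁² + q₁τ₁b₂²) + 2τ₁τ₂τ_G(q₂τ₁ + q₁τ₂)b₁b₂`.
Every term is nonnegative for nonnegative data with `N_i ≥ 0`, although the quadratic remainder is not positive semidefinite.
[this work] -/
theorem pvp_parallel_identity (q₁ a₁ b₁ c₁ d₁ q₂ a₂ b₂ c₂ d₂ : ℝ) :
    (1 - q₁) * (1 - q₂) *
      (2 * (1 - q₁ * q₂) *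
          (((a₁ * q₂ + q₁ * a₂) + (c₁ + c₂ + (1 - q₂) * (a₁ + b₁) + (1 - q₁) * (a₂ + b₂))) * (b₁ * q₂ + q₁ * b₂)
            - (d₁ * q₂ + q₁ * d₂ + a₁ * b₂ + a₂ * b₁))
        - ((q₁ * q₂) * (c₁ + c₂ + (1 - q₂) * (a₁ + b₁) + (1 - q₁) * (a₂ + b₂))
            - (1 - q₁ * q₂) * (a₁ * q₂ + q₁ * a₂)) ^ 2) =
    (1 - q₂) * q₂ * (1 - q₁ * q₂) * (2 * (1 - q₁) * ((a₁ + c₁) * b₁ - d₁) - (q₁ * c₁ - (1 - q₁) * a₁) ^ 2)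
    + (1 - q₁) * q₁ * (1 - q₁ * q₂) * (2 * (1 - q₂) * ((a₂ + c₂) * b₂ - d₂) - (q₂ * c₂ - (1 - q₂) * a₂) ^ 2)
    + q₁ * q₂ * ((1 - q₂) * (q₁ * c₁ - (1 - q₁) * a₁) - (1 - q₁) * (q₂ * c₂ - (1 - q₂) * a₂)
        + (1 - q₁) * (1 - q₂) * (q₁ * b₂ - q₂ * b₁)) ^ 2
    + q₂ * (1 - q₁) * (1 - q₂) ^ 2 * (q₁ * c₁ - (1 - q₁) * a₁) ^ 2
    + q₁ * (1 - q₁) ^ 2 * (1 - q₂) * (q₂ * c₂ - (1 - q₂) * a₂) ^ 2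
    + 2 * (1 - q₁) * (1 - q₂) * ((1 - q₁ * q₂) ^ 2 + q₁ * q₂ * (1 - q₁) * (1 - q₂))
        * (b₂ * (q₁ * c₁ - (1 - q₁) * a₁) + b₁ * (q₂ * c₂ - (1 - q₂) * a₂))
    + ((1 - q₁ * q₂) + ((1 - q₁ * q₂) ^ 2 + q₁ * q₂ * (1 - q₁) * (1 - q₂))) * (1 - q₁) * (1 - q₂)
        * (q₂ * (1 - q₂) * b₁ ^ 2 + q₁ * (1 - q₁) * b₂ ^ 2)
    + 2 * (1 - q₁) * (1 - q₂) * (1 - q₁ * q₂) * (q₂ * (1 - q₁) + q₁ * (1 - q₂)) * b₁ * b₂ := by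
  ring

/-- **(PV) for nonnegative loads is preserved by parallel composition.**  If `0 ≤ q_i < 1`, the data are nonnegative, both pieces
satisfy Harris `N_i ≥ 0` and (PV) `N_i² ≤ 2τ_iΓ_i`, then the parallel composite satisfies (PV) — read off the certificate
`pvp_parallel_identity`. [this work] -/
theorem pvp_parallel (q₁ a₁ b₁ c₁ d₁ q₂ a₂ b₂ c₂ d₂ : ℝ)
    (hq₁ : 0 ≤ q₁) (hq₁' : q₁ < 1) (hq₂ : 0 ≤ q₂) (hq₂' : q₂ < 1) (hb₁ : 0 ≤ b₁) (hb₂ : 0 ≤ b₂)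
    (hN₁ : 0 ≤ q₁ * c₁ - (1 - q₁) * a₁) (hN₂ : 0 ≤ q₂ * c₂ - (1 - q₂) * a₂)
    (h₁ : (q₁ * c₁ - (1 - q₁) * a₁) ^ 2 ≤ 2 * (1 - q₁) * ((a₁ + c₁) * b₁ - d₁))
    (h₂ : (q₂ * c₂ - (1 - q₂) * a₂) ^ 2 ≤ 2 * (1 - q₂) * ((a₂ + c₂) * b₂ - d₂)) :
    ((q₁ * q₂) * (c₁ + c₂ + (1 - q₂) * (a₁ + b₁) + (1 - q₁) * (a₂ + b₂))
        - (1 - q₁ * q₂) * (a₁ * q₂ + q₁ * a₂)) ^ 2 ≤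
      2 * (1 - q₁ * q₂) *
        (((a₁ * q₂ + q₁ * a₂) + (c₁ + c₂ + (1 - q₂) * (a₁ + b₁) + (1 - q₁) * (a₂ + b₂))) * (b₁ * q₂ + q₁ * b₂)
          - (d₁ * q₂ + q₁ * d₂ + a₁ * b₂ + a₂ * b₁)) := by
  have hid := pvp_parallel_identity q₁ a₁ b₁ c₁ d₁ q₂ a₂ b₂ c₂ d₂
  have hτ₁ : 0 < 1 - q₁ := by linarith
  have hτ₂ : 0 < 1 - q₂ := by linarith
  have hτG : 0 ≤ 1 - q₁ * q₂ := by nlinarith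
  have hφ : 0 ≤ (1 - q₁ * q₂) ^ 2 + q₁ * q₂ * (1 - q₁) * (1 - q₂) := by positivity
  set N₁ := q₁ * c₁ - (1 - q₁) * a₁ with hN₁def
  set N₂ := q₂ * c₂ - (1 - q₂) * a₂ with hN₂def
  set X := 2 * (1 - q₁ * q₂) *
        (((a₁ * q₂ + q₁ * a₂) + (c₁ + c₂ + (1 - q₂) * (a₁ + b₁) + (1 - q₁) * (a₂ + b₂))) * (b₁ * q₂ + q₁ * b₂)
          - (d₁ * q₂ + q₁ * d₂ + a₁ * b₂ + a₂ * b₁))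
        - ((q₁ * q₂) * (c₁ + c₂ + (1 - q₂) * (a₁ + b₁) + (1 - q₁) * (a₂ + b₂))
            - (1 - q₁ * q₂) * (a₁ * q₂ + q₁ * a₂)) ^ 2 with hX
  have s₁ : 0 ≤ 2 * (1 - q₁) * ((a₁ + c₁) * b₁ - d₁) - N₁ ^ 2 := by linarith
  have s₂ : 0 ≤ 2 * (1 - q₂) * ((a₂ + c₂) * b₂ - d₂) - N₂ ^ 2 := by linarith
  have t1 : 0 ≤ (1 - q₂) * q₂ * (1 - q₁ * q₂) * (2 * (1 - q₁) * ((a₁ + c₁) * b₁ - d₁) - N₁ ^ 2) := by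
    have : 0 ≤ (1 - q₂) * q₂ * (1 - q₁ * q₂) := by positivity
    exact mul_nonneg this s₁
  have t2 : 0 ≤ (1 - q₁) * q₁ * (1 - q₁ * q₂) * (2 * (1 - q₂) * ((a₂ + c₂) * b₂ - d₂) - N₂ ^ 2) := by
    have : 0 ≤ (1 - q₁) * q₁ * (1 - q₁ * q₂) := by positivity
    exact mul_nonneg this s₂
  have t3 : 0 ≤ q₁ * q₂ * ((1 - q₂) * N₁ - (1 - q₁) * N₂ + (1 - q₁) * (1 - q₂) * (q₁ * b₂ - q₂ * b₁)) ^ 2 := by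
    positivity
  have t4 : 0 ≤ q₂ * (1 - q₁) * (1 - q₂) ^ 2 * N₁ ^ 2 := by positivity
  have t5 : 0 ≤ q₁ * (1 - q₁) ^ 2 * (1 - q₂) * N₂ ^ 2 := by positivity
  have t6 : 0 ≤ 2 * (1 - q₁) * (1 - q₂) * ((1 - q₁ * q₂) ^ 2 + q₁ * q₂ * (1 - q₁) * (1 - q₂))
      * (b₂ * N₁ + b₁ * N₂) := by
    have : 0 ≤ b₂ * N₁ + b₁ * N₂ := by positivity
    positivity
  have t7 : 0 ≤ ((1 - q₁ * q₂) + ((1 - q₁ * q₂) ^ 2 + q₁ * q₂ * (1 - q₁) * (1 - q₂))) * (1 - q₁) * (1 - q₂)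
      * (q₂ * (1 - q₂) * b₁ ^ 2 + q₁ * (1 - q₁) * b₂ ^ 2) := by positivity
  have t8 : 0 ≤ 2 * (1 - q₁) * (1 - q₂) * (1 - q₁ * q₂) * (q₂ * (1 - q₁) + q₁ * (1 - q₂)) * b₁ * b₂ := by positivity
  have hprod : 0 ≤ (1 - q₁) * (1 - q₂) * X := by
    rw [hX, hid]; linarith
  have hpos : 0 < (1 - q₁) * (1 - q₂) := mul_pos hτ₁ hτ₂
  have hX0 : 0 ≤ X := by
    by_contra hneg
    have hlt : X < 0 := lt_of_not_ge hneg
    have := mul_neg_of_pos_of_neg hpos hlt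
    linarith
  rw [hX] at hX0
  linarith

end APL

end Summit.CriticalPhenomena.PercolationContinuityZ3.Theorems
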